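import Summits.NavierStokesRegularity.NavierStokesRegularity.Theorems.TypeIQuarterGateLorentzUpgradeIffQuarterLaw
import Summits.NavierStokesRegularity.NavierStokesRegularity.Theorems.LerayQuarterDissipationEnstrophyQuarterLawIffCount
import HarnessLib

/-!
# `TypeIQuarterGate`: the quarter deck restated with the Lorentz upgrade

With `LorentzOfEnvelope.lorentzUpgradeTypeI_iff_quarterLawTypeI` (24108 ⟺ 23726, this seat) the landed
quarter deck (`QuarterDeck.enstrophyQuarterLaw_iff_noTypeII_and_quarterLawTypeI`,
`…navierStokesRegularity_iff_noTypeII_and_quarterLawTypeI_of_parabolicGaldiLiouville`) reads in the Lorentz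
currency:

* `enstrophyQuarterLaw_iff_noTypeII_and_lorentzUpgradeTypeI` — shelf 1574 (`EnstrophyQuarterLaw`: Leray's
  quarter rate for EVERY maximal Leray–Hopf solution from rapidly decaying data) ⟺ «every such blow-up is
  Type I in the sup-norm sense» (0056) ∧ «every sup-norm Type-I blow-up is Type I in the Lorentz sense
  `sup_t ‖u(t)‖_{L^{3,∞}} < ∞`» (24108): the enstrophy quarter law IS the coincidence of the two Type-I
  notions that Albritton–Barker (arXiv:1811.00502 Rem. 3.2) single out as not known to imply each other.
* `navierStokesRegularity_iff_noTypeII_and_lorentzUpgradeTypeI_of_parabolicGaldiLiouville` — under the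
  route's Liouville back end `ParabolicGaldiLiouville` (0893): Clay (A) ⟺ NoTypeII ∧ LorentzUpgradeTypeI.

HONEST FRAMING: equivalences between OPEN statements (conditional on 0893 for the summit form); nothing
about Navier–Stokes regularity is proved. [folklore]
-/

-- the problem directory repeats the summit name (`NavierStokesRegularity/NavierStokesRegularity`)
set_option linter.dupNamespace false

noncomputable section

namespace Summit.NavierStokesRegularity.NavierStokesRegularity.Theorems

namespace LorentzOfEnvelope

open Summit.NavierStokesRegularity.NavierStokesRegularity.Theses

/-- **Shelf 1574 ⟺ the two Type-I notions coincide**: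
`EnstrophyQuarterLaw ↔ NoTypeII ∧ LorentzUpgradeTypeI` (1574 ⟺ 0056 ∧ 24108). [folklore] -/
theorem enstrophyQuarterLaw_iff_noTypeII_and_lorentzUpgradeTypeI :
    LerayQuarterDissipation.EnstrophyQuarterLaw ↔
      (TypeIQuarterGate.NoTypeII ∧ TypeIQuarterGate.LorentzUpgradeTypeI) := by
  rw [QuarterDeck.enstrophyQuarterLaw_iff_noTypeII_and_quarterLawTypeI,
    lorentzUpgradeTypeI_iff_quarterLawTypeI]

/-- **Under `ParabolicGaldiLiouville` (0893): Clay (A) ⟺ NoTypeII ∧ LorentzUpgradeTypeI** — the route's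
summit equivalence in the Lorentz currency. [folklore] -/
theorem navierStokesRegularity_iff_noTypeII_and_lorentzUpgradeTypeI_of_parabolicGaldiLiouville
    (hP : TypeIQuarterGate.ParabolicGaldiLiouville) :
    _root_.NavierStokesRegularity ↔
      (TypeIQuarterGate.NoTypeII ∧ TypeIQuarterGate.LorentzUpgradeTypeI) := by
  rw [QuarterDeck.navierStokesRegularity_iff_noTypeII_and_quarterLawTypeI_of_parabolicGaldiLiouville hP,
    lorentzUpgradeTypeI_iff_quarterLawTypeI]

/-- **Under the canonical Liouville conjecture (L)**: Clay (A) ⟺ NoTypeII ∧ LorentzUpgradeTypeI. [folklore] -/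
theorem navierStokesRegularity_iff_noTypeII_and_lorentzUpgradeTypeI_of_liouvilleConjectureNS
    (hLiou : _root_.Summit.NavierStokesRegularity.NavierStokesRegularity.LiouvilleConjectureNS) :
    _root_.NavierStokesRegularity ↔
      (TypeIQuarterGate.NoTypeII ∧ TypeIQuarterGate.LorentzUpgradeTypeI) := by
  rw [QuarterDeck.navierStokesRegularity_iff_noTypeII_and_quarterLawTypeI_of_liouvilleConjectureNS hLiou,
    lorentzUpgradeTypeI_iff_quarterLawTypeI]

end LorentzOfEnvelope

end Summit.NavierStokesRegularity.NavierStokesRegularity.Theorems
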